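import Summits.MatrixMultiplication.OmegaCensus.BoxBadKleinRotation
import Summits.MatrixMultiplication.OmegaCensus.BoxUsefulCentreLiftCore

/-!
# ω-census, family (b3): conjecture C9 (b) — `3`-elements of a box-useful group: they centralise normal exponent-`2` subgroups, and inverted ones have order `≤ 3`

HONEST FRAMING (pub-omega census; verbatim): lottery ticket; floor = certified bounds/negative ranges.
Census BOOKKEEPING (conjecture C9 of the cell, STRUCTURE.md §2; pub-omega kernel-l4 gen 16, task K-5, structure part): two
corollaries of the uniform configuration theorems in the form the centreless branch of the non-nilpotent analysis consumes them.
* `ThreeElt.comm_of_exp_two` (from `KleinRot.not_boxUseful_of_rot3`): in a box-useful group, an element `r` some `3^k`-th power of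
  which centralises a normal subgroup `V` of exponent `≤ 2` already centralises `V` (take the last power `r₀ = r^{3^{m-1}}` acting
  non-trivially: `v, v^{r₀}, v^{r₀²}` are commuting involutions permuted `3`-cyclically).  In particular every element of
  `3`-power order centralises every normal elementary abelian `2`-subgroup — the `p = 2` half of 'a minimal normal subgroup of a
  centreless box-useful {2,3}-group is a `3`-group'.
* `ThreeElt.pow_three_eq_one_of_inverted` (from `D18Config.not_boxUseful`): in a box-useful group, an element of `3`-power order
  that is inverted by some element has order `≤ 3`.
Nothing here is progress on `ω`.
-/

namespace Summit.MatrixMultiplication.OmegaCensus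

open Finset ProductBoxBound

namespace ThreeElt

variable {G : Type*} [Group G] [Fintype G] [DecidableEq G]

/-- **`3`-elements centralise normal exponent-`2` subgroups of a box-useful group.**  If `V ⊴ G` has exponent `≤ 2` and
`r ^ 3 ^ k` centralises `V`, then `r` centralises `V`. [folklore] -/
theorem comm_of_exp_two (hG : BoxUseful G) (V : Subgroup G) [hVn : V.Normal] (hV2 : ∀ v ∈ V, v * v = 1) (r : G) {k : ℕ}
    (hk : ∀ v ∈ V, r ^ 3 ^ k * v = v * r ^ 3 ^ k) : ∀ v ∈ V, r * v = v * r := by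
  classical
  -- `V` is abelian
  have hVcomm : ∀ v ∈ V, ∀ w ∈ V, v * w = w * v := by
    intro v hv w hw
    have e : v * w * (v * w) = 1 := hV2 _ (V.mul_mem hv hw)
    calc v * w = v * w * (v * w) * (w⁻¹ * v⁻¹) := by group
      _ = w⁻¹ * v⁻¹ := by rw [e, one_mul]
      _ = w * v := by
          rw [inv_eq_of_mul_eq_one_right (hV2 w hw), inv_eq_of_mul_eq_one_right (hV2 v hv)]
  -- the least `m` with `r^(3^m)` centralising `V`
  have hex : ∃ m, ∀ v ∈ V, r ^ 3 ^ m * v = v * r ^ 3 ^ m := ⟨k, hk⟩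
  set m := Nat.find hex with hm
  have hmspec : ∀ v ∈ V, r ^ 3 ^ m * v = v * r ^ 3 ^ m := Nat.find_spec hex
  by_contra hnot
  push Not at hnot
  obtain ⟨v₀, hv₀, hne₀⟩ := hnot
  have hm0 : m ≠ 0 := by
    intro h0
    have := hmspec v₀ hv₀
    rw [h0, pow_zero, pow_one] at this
    exact hne₀ this
  -- `r₀ = r^(3^(m-1))` does not centralise `V`, but `r₀³` does
  set r₀ := r ^ 3 ^ (m - 1) with hr₀
  have hmin : ¬ ∀ v ∈ V, r₀ * v = v * r₀ := by
    rw [hr₀]; exact Nat.find_min hex (show m - 1 < m by omega)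
  push Not at hmin
  obtain ⟨v, hv, hne⟩ := hmin
  have hr₀3 : r₀ * r₀ * r₀ = r ^ 3 ^ m := by
    have e3 : 3 ^ (m - 1) * 3 = 3 ^ m := by rw [← pow_succ]; congr 1; omega
    rw [show r₀ * r₀ * r₀ = r₀ ^ 3 by rw [pow_succ, pow_two], hr₀, ← pow_mul, e3]
  -- the three involutions
  have hv1 : r₀ * v * r₀⁻¹ ∈ V := hVn.conj_mem v hv r₀
  have hv2 : r₀ * r₀ * v * r₀⁻¹ * r₀⁻¹ ∈ V := by
    have := hVn.conj_mem _ hv1 r₀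
    simpa only [mul_assoc, mul_inv_rev] using this
  have h3 : r₀ * r₀ * r₀ * v * r₀⁻¹ * r₀⁻¹ * r₀⁻¹ = v := by
    have e := hmspec v hv
    rw [← hr₀3] at e
    calc r₀ * r₀ * r₀ * v * r₀⁻¹ * r₀⁻¹ * r₀⁻¹ = (r₀ * r₀ * r₀ * v) * (r₀ * r₀ * r₀)⁻¹ := by group
      _ = v := by rw [e]; group
  have hne' : r₀ * v * r₀⁻¹ ≠ v := by
    intro h; apply hne
    calc r₀ * v = r₀ * v * r₀⁻¹ * r₀ := by group
      _ = v * r₀ := by rw [h]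
  exact KleinRot.not_boxUseful_of_rot3 (hV2 v hv) (hVcomm _ hv _ hv1) (hVcomm _ hv _ hv2) (hVcomm _ hv1 _ hv2) h3 hne' hG

/-- **Inverted `3`-elements of a box-useful group have order `≤ 3`.** [folklore] -/
theorem pow_three_eq_one_of_inverted (hG : BoxUseful G) {a s : G} {k : ℕ} (ha : a ^ 3 ^ k = 1) (hsa : s * a * s⁻¹ = a⁻¹) :
    a ^ 3 = 1 := by
  classical
  obtain ⟨c, -, hc⟩ := (Nat.dvd_prime_pow Nat.prime_three).1 (orderOf_dvd_of_pow_eq_one ha)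
  by_cases hc2 : 2 ≤ c
  · exfalso
    set a₉ := a ^ 3 ^ (c - 2) with ha₉
    have h9 : orderOf a₉ = 9 := by
      rw [ha₉, orderOf_pow' a (pow_ne_zero _ (by norm_num)), hc, Nat.gcd_eq_right (pow_dvd_pow 3 (by omega)),
        Nat.pow_div (by omega) (by norm_num)]
      have : c - (c - 2) = 2 := by omega
      rw [this]
    have ha9 : a₉ ^ 9 = 1 := by rw [← h9]; exact pow_orderOf_eq_one a₉
    have ha3 : a₉ ^ 3 ≠ 1 := pow_ne_one_of_lt_orderOf (by norm_num) (by rw [h9]; norm_num)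
    have hsa9 : s * a₉ * s⁻¹ = a₉⁻¹ := by rw [ha₉, ← CentreLift.conj_pow', hsa, inv_pow]
    exact D18Config.not_boxUseful ha9 ha3 hsa9 hG
  · have hc1 : c ≤ 1 := by omega
    have hdvd : orderOf a ∣ 3 := by
      rw [hc]; interval_cases c <;> norm_num
    exact orderOf_dvd_iff_pow_eq_one.mp hdvd

end ThreeElt

end Summit.MatrixMultiplication.OmegaCensus
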